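/-
Copyright (c) 2026 the pub-hodgecm-mathlib formalisation cell (harness21).  Prover seat hodgecm-mathlib-K2Liu-p01 (g6), Track B «K2-LIT»,
Road I organ (A-int)-fin, A2c «the junction pin»: implementers over the Siegel parabolic are scalar multiples of Weil's explicit operators, and the
Kudla–Rallis map through them (LEAD F0P6-plan (g12) 07:50:25Z «A2c's pin `toRep (sΔ′ g) = χ′(g) • leviOp (ρ g)` is the right junction to (β-1)»).
KERNEL: theorems only.
-/
import Summits.HodgeConjecture.HodgeConjecture.Theorems.K2LiuKudlaRallisMapEquivariance   -- ★ A2a p858378 (`krFun_leviOp`, `krFun_unipotentOp`)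
import Summits.HodgeConjecture.HodgeConjecture.Theorems.K2LiuDoublingModelComparison      -- ★ β-3 p858320 (`isUnit_det_gramRLoc`; brings β-1 `localSchrodingerDelta`, `LocalMpDelta`)
import Literature.RepresentationTheory.HeisenbergGroup.SchrodingerSymplecticGenerators    -- ★ `leviSp`, `leviEquivSB`, `levi_mem_MpPsi`, `unipotentSp`, `unipotentEquivSB`, `unipotent_mem_MpPsi`
import Literature.RepresentationTheory.HeisenbergGroup.SchrodingerLeraySectionGram        -- ★ `implementerUniqueUpToScalar_schrodingerSB_gram`
import Literature.RepresentationTheory.HeisenbergGroup.ImplementerCocycle                 -- ★ `MpPsi.toRep`, `MpPsi.toRep_implements`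
import HarnessLib

/-!
# Crux `HLiu418`, Track B road `K2_Liu`, Road I organ (A-int)-fin — A2c: THE JUNCTION PIN `toRep p = c • (explicit operator)` OVER THE SIEGEL PARABOLIC,
# the character `χ′` of a Levi-valued splitting, and the Kudla–Rallis map through the pairs of `S̃p_ψ`

Cell `hodgecm-mathlib`, crux item hLiu418 = `stmt-HodgeConjecture-24832`, route of record `HCCMUnconditional`; squad K2 ∕ K2Liu, prover K2Liu-p01 (g6).
THEOREMS ONLY (no `def`, no instance, no notation, no named fact, no `sorry`); lane `--supports stmt-HodgeConjecture-24832 --as helper`.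

In the tree the local Weil representation is the TAUTOLOGICAL representation `MpPsi.toRep ρ : (g, M) ↦ M` of MVW's group of pairs `S̃p_ψ = MpPsi ρ` (★ `LocalWeilProjective`,
★ `ImplementerCocycle`); the groups `U(W)_w`, `U(V′_w)` act through splittings `s : G →* MpPsi ρ` (★ β-1 `mpTransportLoc Γ ∘ s`).  What A2a∕A2b∕the Fourier clause
prove is the behaviour of the Kudla–Rallis map under Weil's EXPLICIT operators (★ `leviOp`, ★ `unipotentOp`, ★ `betaFourier`).  The junction is implementer UNIQUENESS
UP TO A SCALAR (MVW Chap. 2 II.1 «M est unique à un scalaire près», ★ `ImplementerUniqueUpToScalar`, a THEOREM for Gram models over local fields ★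
`implementerUniqueUpToScalar_schrodingerSB_gram`):

* §1 (any Schrödinger model with unique implementers) **`exists_toRep_eq_smul_leviEquivSB`**: if `p ∈ S̃p_ψ` lies over the Levi element `m(a,d)` then
  `toRep p = c • leviEquivSB a` for some `c ∈ ℂˣ`; **`exists_toRep_eq_smul_unipotentEquivSB`**: over `n(b)`, `toRep p = c • unipotentEquivSB (½β(·, b·))`.
* §2 **`exists_character_toRep_eq_smul`** — for a splitting `s : G →* S̃p_ψ` lying over a LEVI-VALUED homomorphism `g ↦ m(ρ g, d g)`, the scalars form a
  CHARACTER: `∃ χ′ : G →* ℂˣ, toRep (s g) = χ′(g) • leviEquivSB (ρ g)` — the `χ′` of RULING M-156l (A4″-K) (K2E5-plan (g6) (c1)): `U(V′_w)` acts through `1_ℓ ⊗ g`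
  by `leviOp` up to the character `χ′`; and `f_{ω(g)Φ} = χ′(g) · f_Φ` for the evaluation-at-`0` section (`swSection_toRep_eq`), so `K′`-invariant `Φ` have
  `K′`-invariant sections iff `χ′|_{K′} = 1`.
* §3 the Kudla–Rallis map THROUGH THE PAIRS (★ A2a + §1): `krFun θ μ (toRep p Φ) u = c · ‖det D‖⁻¹ · (leviOp aβ (krFun θ μ Φ))(u)` over Levi pairs with the slice
  hypothesis of ★ `krFun_leviOp`; `= c · (unipotentOp ψ qβ (krFun θ μ Φ))(u)` over unipotent pairs with the slice hypothesis of ★ `krFun_unipotentOp`.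
* §4 (β-1 BY NAME) **`implementerUniqueUpToScalar_localSchrodingerDelta`** — the doubling-polarised model of ★ `K2LiuDoublingSchrodingerModelDefs` has unique
  implementers (`det J_{Δ,v}` a unit: ★ `isUnit_det_deltaGram` ∘ ★ `isUnit_det_gramRLoc`), so §1–§3 apply to every `p : LocalMpDelta v`, in particular to
  `p = (mpTransportLoc Γ ∘ s) h` for `h` in the Siegel parabolic `P_Δ` or in `P′_w ⊂ U(V′_w)` once `proj p` is identified as `leviSp`∕`unipotentSp` in the frame
  (the «geometric actions» of (β-1) §6, by the Witt frame `θ_w` BY NAME — not here).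

HONEST LABEL: HC_CM is proved only modulo the printed citations (2 remaining named inputs: hLiu418 = stmt-HodgeConjecture-24832, h413 = stmt-HodgeConjecture-24833)
until rung 0 closes; helper, closes no item.
References: [MoeglinVignerasWaldspurger1987] Chap. 2 II.1 (A)(B), II.6; [Weil1964] n° 13, n° 34; [Kudla1994] §3 Thm. 3.1 (the splitting and its character on the Siegel parabolic);
[GanQiuTakeda2014] §2.8; [KudlaRallis1994] §1; [HarrisKudlaSweet1996] §1 (1.8)–(1.11).
-/

set_option autoImplicit false
set_option linter.dupNamespace false -- the mandated namespace repeats `HodgeConjecture.HodgeConjecture`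

noncomputable section

open MeasureTheory Matrix Topology
open scoped NNReal
open NumberField IsDedekindDomain
open Literature.NumberTheory.GaloisRepresentations.IsNonarchimedeanLocalField
open Literature.NumberTheory.Automorphic Literature.RepresentationTheory.HeisenbergGroup
open Literature.NumberTheory.GelbartRogawski1991 Literature.NumberTheory.GelbartRogawski1991.GRConstruction
open Literature.NumberTheory.GelbartRogawski1991.UnitaryDualPair.LocalSplitting
open Summit.HodgeConjecture.HodgeConjecture.Cruxes.HLiu418.K2LiuKudlaRallisMapDefs
open Summit.HodgeConjecture.HodgeConjecture.Cruxes.HLiu418.K2LiuKudlaRallisMapEquivariance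
open Summit.HodgeConjecture.HodgeConjecture.Cruxes.HLiu418.K2LiuDoublingSchrodingerModelDefs
open Summit.HodgeConjecture.HodgeConjecture.Cruxes.HLiu418.K2LiuDoublingModelComparison

namespace Summit.HodgeConjecture.HodgeConjecture.Cruxes.HLiu418.K2LiuKudlaRallisMapDeltaModel

universe u v w

/-! ## §1 Pairs over Levi and unipotent elements are scalar multiples of Weil's operators -/

section Pairs

variable {R : Type u} [CommRing R] [Invertible (2 : R)] {X : Type v} {Y : Type w} [AddCommGroup X] [Module R X]
  [AddCommGroup Y] [Module R Y] (β : X →ₗ[R] Y →ₗ[R] R) (ψ : AddChar R Circle)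
  [TopologicalSpace X] [TopologicalSpace R] [IsTopologicalAddGroup X]
  (hψ : IsLocallyConstant (⇑ψ : R → Circle)) (hβ : ∀ y : Y, Continuous fun u : X => β u y)

/-- **A PAIR OVER A LEVI ELEMENT ACTS BY A SCALAR MULTIPLE OF WEIL's `d₀(a)`**: if implementers of `ρ = schrodingerSB β ψ` are unique up to scalars and
`p = (m(a,d), M) ∈ S̃p_ψ`, then `M = c • leviEquivSB a` (`(M f)(u) = c · f(a⁻¹ u)`) for some `c ∈ ℂˣ` — ★ `levi_mem_MpPsi` gives one implementer, uniqueness the rest.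
[cite: MoeglinVignerasWaldspurger1987, Chap. 2 II.1 (A), II.6] [cite: Weil1964, n° 13] -/
theorem exists_toRep_eq_smul_leviEquivSB (hU : ImplementerUniqueUpToScalar (schrodingerSB β ψ hψ hβ))
    (a : X ≃ₗ[R] X) (d : Y ≃ₗ[R] Y) (had : ∀ x y, β (a x) (d y) = β x y) (ha : Continuous a) (ha' : Continuous a.symm)
    (p : MpPsi (schrodingerSB β ψ hψ hβ)) (hp : MpPsi.proj (schrodingerSB β ψ hψ hβ) p = leviSp β a d had) :
    ∃ c : ℂˣ, ∀ f : SchwartzBruhat X, MpPsi.toRep (schrodingerSB β ψ hψ hβ) p f = (c : ℂ) • leviEquivSB a ha ha' f := by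
  have hM : Implements (schrodingerSB β ψ hψ hβ) (ofSymplectic _ (leviSp β a d had)) (leviEquivSB a ha ha') :=
    (mem_MpPsi _ _).1 (levi_mem_MpPsi β ψ hψ hβ a d had ha ha')
  have hM' : Implements (schrodingerSB β ψ hψ hβ) (ofSymplectic _ (leviSp β a d had)) (MpPsi.toOp (schrodingerSB β ψ hψ hβ) p) := by
    have h := MpPsi.toRep_implements (schrodingerSB β ψ hψ hβ) p
    rwa [← MpPsi.proj_apply, hp] at h
  obtain ⟨c, hc⟩ := hU _ _ _ hM hM'
  exact ⟨c, fun f => hc f⟩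

/-- **A PAIR OVER A UNIPOTENT ELEMENT ACTS BY A SCALAR MULTIPLE OF WEIL's `t₀(b)`**: `p = (n(b), M) ∈ S̃p_ψ` (`b` symmetric) has
`M = c • unipotentEquivSB (½β(·, b·))` (`(M f)(u) = c · ψ(−½β(u, bu)) f(u)`). [cite: MoeglinVignerasWaldspurger1987, Chap. 2 II.1 (A), II.6] [cite: Weil1964, n° 13] -/
theorem exists_toRep_eq_smul_unipotentEquivSB [ContinuousNeg R] (hU : ImplementerUniqueUpToScalar (schrodingerSB β ψ hψ hβ))
    (b : X →ₗ[R] Y) (hb : ∀ x x', β x (b x') = β x' (b x)) (hq : Continuous fun x : X => ⅟(2 : R) * β x (b x))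
    (p : MpPsi (schrodingerSB β ψ hψ hβ)) (hp : MpPsi.proj (schrodingerSB β ψ hψ hβ) p = unipotentSp β b hb) :
    ∃ c : ℂˣ, ∀ f : SchwartzBruhat X,
      MpPsi.toRep (schrodingerSB β ψ hψ hβ) p f = (c : ℂ) • unipotentEquivSB ψ hψ (fun x => ⅟(2 : R) * β x (b x)) hq f := by
  have hM : Implements (schrodingerSB β ψ hψ hβ) (ofSymplectic _ (unipotentSp β b hb)) (unipotentEquivSB ψ hψ (fun x => ⅟(2 : R) * β x (b x)) hq) :=
    (mem_MpPsi _ _).1 (unipotent_mem_MpPsi β ψ hψ hβ b hb hq)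
  have hM' : Implements (schrodingerSB β ψ hψ hβ) (ofSymplectic _ (unipotentSp β b hb)) (MpPsi.toOp (schrodingerSB β ψ hψ hβ) p) := by
    have h := MpPsi.toRep_implements (schrodingerSB β ψ hψ hβ) p
    rwa [← MpPsi.proj_apply, hp] at h
  obtain ⟨c, hc⟩ := hU _ _ _ hM hM'
  exact ⟨c, fun f => hc f⟩

/-! ## §2 A splitting over a Levi-valued homomorphism acts through `leviEquivSB` up to a CHARACTER -/

/-- **THE CHARACTER `χ′` OF A LEVI-VALUED SPLITTING**: let `s : G →* S̃p_ψ` lie over `g ↦ m(ρ g, d g)` with `ρ : G →* GL(X)` a homomorphism (`d` any companion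
with `β(ρ g x, d g y) = β(x, y)`); if implementers are unique up to scalars and `𝒮(X) ≠ 0`, there is a CHARACTER `χ′ : G →* ℂˣ` with
`toRep (s g) f = χ′(g) • leviEquivSB (ρ g) f` for all `g, f` — e.g. `G = U(V′_w)` acting on `X_Δ = ℓ_∇ ⊗ V′_w` through `1 ⊗ g` (RULING M-156l: the `χ′` of (A4″-K)).
[cite: MoeglinVignerasWaldspurger1987, Chap. 2 II.1 (B)] [cite: Kudla1994, §3 Thm. 3.1] -/
theorem exists_character_toRep_eq_smul (hU : ImplementerUniqueUpToScalar (schrodingerSB β ψ hψ hβ))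
    {G : Type*} [Group G] (s : G →* MpPsi (schrodingerSB β ψ hψ hβ)) (ρ : G →* (X ≃ₗ[R] X)) (d : G → (Y ≃ₗ[R] Y))
    (had : ∀ g x y, β (ρ g x) (d g y) = β x y) (hc : ∀ g, Continuous (ρ g)) (hc' : ∀ g, Continuous (ρ g).symm)
    (hp : ∀ g, MpPsi.proj (schrodingerSB β ψ hψ hβ) (s g) = leviSp β (ρ g) (d g) (had g)) (f₀ : SchwartzBruhat X) (hf₀ : f₀ ≠ 0) :
    ∃ χ : G →* ℂˣ, ∀ (g : G) (f : SchwartzBruhat X),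
      MpPsi.toRep (schrodingerSB β ψ hψ hβ) (s g) f = (χ g : ℂ) • leviEquivSB (ρ g) (hc g) (hc' g) f := by
  choose c hcg using fun g => exists_toRep_eq_smul_leviEquivSB β ψ hψ hβ hU (ρ g) (d g) (had g) (hc g) (hc' g) (s g) (hp g)
  -- the Levi operators are multiplicative on `𝒮(X)`
  have hL : ∀ (g h : G) (f : SchwartzBruhat X),
      leviEquivSB (ρ (g * h)) (hc (g * h)) (hc' (g * h)) f = leviEquivSB (ρ g) (hc g) (hc' g) (leviEquivSB (ρ h) (hc h) (hc' h) f) := by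
    intro g h f
    apply Subtype.ext
    rw [coe_leviEquivSB, coe_leviEquivSB, coe_leviEquivSB, map_mul, leviOp_mul, LinearEquiv.mul_apply]
  -- hence the scalars are multiplicative
  have hmul : ∀ g h : G, c (g * h) = c g * c h := by
    intro g h
    have h1 : MpPsi.toRep (schrodingerSB β ψ hψ hβ) (s (g * h)) f₀ =
        MpPsi.toRep (schrodingerSB β ψ hψ hβ) (s g) (MpPsi.toRep (schrodingerSB β ψ hψ hβ) (s h) f₀) := by
      rw [map_mul, map_mul, Module.End.mul_apply]
    rw [hcg, hcg, hcg, map_smul, smul_smul, hL] at h1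
    have hne : leviEquivSB (ρ g) (hc g) (hc' g) (leviEquivSB (ρ h) (hc h) (hc' h) f₀) ≠ 0 := by
      intro h0
      exact hf₀ (by simpa using congrArg (fun v => (leviEquivSB (ρ h) (hc h) (hc' h)).symm ((leviEquivSB (ρ g) (hc g) (hc' g)).symm v)) h0)
    exact Units.ext (smul_left_injective ℂ hne h1)
  exact ⟨MonoidHom.mk' c hmul, fun g f => hcg g f⟩

/-- **the evaluation-at-`0` section through such a splitting**: `(toRep (s g) Φ)(0) = χ′(g) · Φ(0)` — `U(V′_w)` acts LINEARLY, fixing `0`, so `f_{ω(g)Φ} = χ′(g) f_Φ` and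
`K′`-invariance of `Φ` passes to the section exactly when `χ′|_{K′} = 1` (the (W3) invariance of `Φ ↦ f_Φ` used in RULING M-156l). [cite: Kudla1994, §3 Thm. 3.1] [cite: KudlaRallis1994, §1] -/
theorem toRep_apply_zero_eq_smul {G : Type*} [Group G] (s : G →* MpPsi (schrodingerSB β ψ hψ hβ)) (ρ : G →* (X ≃ₗ[R] X))
    (hc : ∀ g, Continuous (ρ g)) (hc' : ∀ g, Continuous (ρ g).symm) (χ : G →* ℂˣ)
    (hχ : ∀ (g : G) (f : SchwartzBruhat X), MpPsi.toRep (schrodingerSB β ψ hψ hβ) (s g) f = (χ g : ℂ) • leviEquivSB (ρ g) (hc g) (hc' g) f)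
    (g : G) (Φ : SchwartzBruhat X) :
    ((MpPsi.toRep (schrodingerSB β ψ hψ hβ) (s g) Φ : SchwartzBruhat X) : X → ℂ) 0 = (χ g : ℂ) * (Φ : X → ℂ) 0 := by
  rw [hχ g Φ, Submodule.coe_smul, Pi.smul_apply, coe_leviEquivSB, leviOp_apply, map_zero, smul_eq_mul]

end Pairs

/-! ## §3 The Kudla–Rallis map through the pairs of `S̃p_ψ` -/

section KR

variable {K : Type*} [Field K] [ValuativeRel K] [TopologicalSpace K] [IsNonarchimedeanLocalField K] [Invertible (2 : K)]
  [MeasurableSpace K] [BorelSpace K] [SecondCountableTopology K]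
  {X : Type*} [TopologicalSpace X] [AddCommGroup X] [Module K X] [IsTopologicalAddGroup X]
  {Y : Type*} [AddCommGroup Y] [Module K Y] (B : X →ₗ[K] Y →ₗ[K] K) (ψ : AddChar K Circle)
  (hψ : IsLocallyConstant (⇑ψ : K → Circle)) (hB : ∀ y : Y, Continuous fun u : X => B u y)
  {α β γ : Type*} [Fintype α] [DecidableEq α] [MeasurableSpace (α → K)] [BorelSpace (α → K)]
  (θ : X ≃ₜ ((β ⊕ γ) ⊕ α → K)) (μ : Measure (α → K)) [μ.IsAddHaarMeasure]

/-- **THE KUDLA–RALLIS MAP THROUGH A LEVI PAIR**: for `p ∈ S̃p_ψ` over `m(a, d)` and the slice hypothesis of ★ `krFun_leviOp` for `a` (base moved by `aβ`, integrated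
block moved by `D`), ONE scalar `c ∈ ℂˣ` with `r (ω(p) Φ)(u) = c · ‖det D‖_K⁻¹ · (r Φ)(aβ⁻¹ u)` for all `Φ, u` — the Siegel Levi `M_Δ`, and `GL(X′)·U(a′_w) ⊂ P′_w`.
[cite: GanQiuTakeda2014, §2.8] [cite: MoeglinVignerasWaldspurger1987, Chap. 2 II.6] -/
theorem exists_krFun_toRep_levi (hU : ImplementerUniqueUpToScalar (schrodingerSB B ψ hψ hB))
    (a : X ≃ₗ[K] X) (d : Y ≃ₗ[K] Y) (had : ∀ x y, B (a x) (d y) = B x y) (ha : Continuous a) (ha' : Continuous a.symm)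
    (p : MpPsi (schrodingerSB B ψ hψ hB)) (hp : MpPsi.proj (schrodingerSB B ψ hψ hB) p = leviSp B a d had)
    (aβ : (β → K) ≃ₗ[K] (β → K)) (c₀ : (β → K) → (α → K)) (D : Matrix α α K) (hD : IsUnit D.det)
    (hS : ∀ (u : β → K) (t : α → K), θ (a.symm (krPoint θ u t)) = Sum.elim (Sum.elim (aβ.symm u) 0) (D *ᵥ t + c₀ u)) :
    ∃ c : ℂˣ, ∀ (Φ : SchwartzBruhat X) (u : β → K),
      krFun θ μ ((MpPsi.toRep (schrodingerSB B ψ hψ hB) p Φ : SchwartzBruhat X) : X → ℂ) u =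
        (c : ℂ) * (((normAbs K D.det)⁻¹ : ℝ≥0) • leviOp aβ (krFun θ μ Φ) u) := by
  obtain ⟨c, hc⟩ := exists_toRep_eq_smul_leviEquivSB B ψ hψ hB hU a d had ha ha' p hp
  refine ⟨c, fun Φ u => ?_⟩
  rw [hc Φ, Submodule.coe_smul, coe_leviEquivSB, ← krFun_leviOp θ μ a aβ c₀ D hD hS Φ u]
  unfold krFun
  simp only [Pi.smul_apply, smul_eq_mul]
  exact integral_const_mul _ _

omit [MeasurableSpace K] [BorelSpace K] [SecondCountableTopology K] [Fintype α] [DecidableEq α] [BorelSpace (α → K)] [μ.IsAddHaarMeasure] in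
/-- **THE KUDLA–RALLIS MAP THROUGH A UNIPOTENT PAIR**: for `p ∈ S̃p_ψ` over `n(b)` whose second-degree datum `½B(x, bx)` is constant along the slices with value
`qβ u` (★ `krFun_unipotentOp`: `X′` isotropic and orthogonal to `a′_w`), ONE scalar `c` with `r (ω(p) Φ)(u) = c · ψ(−qβ u) · (r Φ)(u)` — the Siegel unipotent radical `N_Δ`.
[cite: GanQiuTakeda2014, §2.8] [cite: MoeglinVignerasWaldspurger1987, Chap. 2 II.6] -/
theorem exists_krFun_toRep_unipotent (hU : ImplementerUniqueUpToScalar (schrodingerSB B ψ hψ hB))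
    (b : X →ₗ[K] Y) (hb : ∀ x x', B x (b x') = B x' (b x)) (hq : Continuous fun x : X => ⅟(2 : K) * B x (b x))
    (p : MpPsi (schrodingerSB B ψ hψ hB)) (hp : MpPsi.proj (schrodingerSB B ψ hψ hB) p = unipotentSp B b hb)
    (qβ : (β → K) → K) (hslice : ∀ (u : β → K) (t : α → K), ⅟(2 : K) * B (krPoint θ u t) (b (krPoint θ u t)) = qβ u) :
    ∃ c : ℂˣ, ∀ (Φ : SchwartzBruhat X) (u : β → K),
      krFun θ μ ((MpPsi.toRep (schrodingerSB B ψ hψ hB) p Φ : SchwartzBruhat X) : X → ℂ) u = (c : ℂ) * unipotentOp ψ qβ (krFun θ μ Φ) u := by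
  obtain ⟨c, hc⟩ := exists_toRep_eq_smul_unipotentEquivSB B ψ hψ hB hU b hb hq p hp
  refine ⟨c, fun Φ u => ?_⟩
  rw [hc Φ, Submodule.coe_smul, coe_unipotentEquivSB, ← krFun_unipotentOp θ μ ψ (fun x : X => ⅟(2 : K) * B x (b x)) qβ u (hslice u) Φ]
  unfold krFun
  simp only [Pi.smul_apply, smul_eq_mul]
  exact integral_const_mul _ _

end KR

/-! ## §4 The doubling-polarised model of (β-1) has unique implementers -/

section Delta

variable (L : Type) [Field L] [NumberField L] [IsCMField L]
variable {N M n : ℕ} (e : Fin N × Fin M ≃ Fin n)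
  (dV : Fin N → L) (hdV : ∀ i, IsCMField.complexConj L (dV i) = dV i) (hdV0 : ∀ i, dV i ≠ 0)
  (dW : Fin M → L) (hdW : ∀ i, IsCMField.complexConj L (dW i) = dW i) (hdW0 : ∀ i, dW i ≠ 0)
  (v : HeightOneSpectrum (𝓞 (Fp L)))

include hdV0 hdW0 in
/-- **IMPLEMENTERS OF THE DOUBLING-POLARISED MODEL ARE UNIQUE UP TO SCALARS**: `ImplementerUniqueUpToScalar (localSchrodingerDelta v)` — `det J_{Δ,v}` is a unit
(★ `isUnit_det_deltaGram`, ★ `isUnit_det_gramRLoc`) and Gram Schrödinger models over local fields have scalar commutant (★ `implementerUniqueUpToScalar_schrodingerSB_gram`,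
MVW II.1).  Hence §1–§3 apply to every `p : LocalMpDelta v`, e.g. `p = (mpTransportLoc Γ ∘ s) h`. [cite: MoeglinVignerasWaldspurger1987, Chap. 2 II.1 (A)(B), I.7] [cite: Kudla1994, §2] -/
theorem implementerUniqueUpToScalar_localSchrodingerDelta :
    ImplementerUniqueUpToScalar (localSchrodingerDelta L e dV hdV dW hdW v) :=
  implementerUniqueUpToScalar_schrodingerSB_gram (deltaGramLoc L e dV hdV dW hdW v)
    (isUnit_det_deltaGram (GRConstruction.e₂ (n := n)) (gramRLoc L e dV hdV dW hdW v) (isUnit_det_gramRLoc L e dV hdV hdV0 dW hdW hdW0 v))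
    (isLocallyConstant_of_isContinuousNontrivial (isContinuousNontrivial_adeleAddCharAt (Fp L) v))
    (K2LiuDoublingSchrodingerModelDefs.continuous_toLinearMap₂'_left L (deltaGramLoc L e dV hdV dW hdW v))
    (isContinuousNontrivial_adeleAddCharAt (Fp L) v)

include hdV0 hdW0 in
/-- **the junction pin in (β-1)'s names**: a pair `p : LocalMpDelta v` over a Levi element `m(a, d)` of `Sp(𝕎_v)[Δ-coordinates]` acts on `𝒮(X_Δ)` by
`toRep p = c • leviEquivSB a`, `c ∈ ℂˣ` — for `p = sΔ g`, `g ∈ U(V′_w)` with `a = 1_ℓ ⊗ g` this is «`ω(g) = χ′(g) • leviOp (1 ⊗ g)`».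
[cite: MoeglinVignerasWaldspurger1987, Chap. 2 II.1, II.6] [cite: Kudla1994, §3 Thm. 3.1] -/
theorem exists_toRep_localSchrodingerDelta_eq_smul_leviEquivSB
    (a : (Fin (n + n) → v.adicCompletion (Fp L)) ≃ₗ[v.adicCompletion (Fp L)] (Fin (n + n) → v.adicCompletion (Fp L)))
    (d : (Fin (n + n) → v.adicCompletion (Fp L)) ≃ₗ[v.adicCompletion (Fp L)] (Fin (n + n) → v.adicCompletion (Fp L)))
    (had : ∀ x y, Matrix.toLinearMap₂' (v.adicCompletion (Fp L)) (deltaGramLoc L e dV hdV dW hdW v) (a x) (d y) =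
      Matrix.toLinearMap₂' (v.adicCompletion (Fp L)) (deltaGramLoc L e dV hdV dW hdW v) x y)
    (ha : Continuous a) (ha' : Continuous a.symm) (p : LocalMpDelta L e dV hdV dW hdW v)
    (hp : MpPsi.proj (localSchrodingerDelta L e dV hdV dW hdW v) p = leviSp _ a d had) :
    ∃ c : ℂˣ, ∀ f : SchwartzBruhat (Fin (n + n) → v.adicCompletion (Fp L)),
      MpPsi.toRep (localSchrodingerDelta L e dV hdV dW hdW v) p f = (c : ℂ) • leviEquivSB a ha ha' f :=
  exists_toRep_eq_smul_leviEquivSB _ _ _ _ (implementerUniqueUpToScalar_localSchrodingerDelta L e dV hdV hdV0 dW hdW hdW0 v) a d had ha ha' p hp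

end Delta

end Summit.HodgeConjecture.HodgeConjecture.Cruxes.HLiu418.K2LiuKudlaRallisMapDeltaModel

end
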